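import Literature.NumberTheory.GaloisRepresentations.HomDualPresentation
import Literature.NumberTheory.GaloisRepresentations.HomPermutationModuleVanishing
import HarnessLib

/-!
# Unit-valued readouts: correcting an equivariant `h : N₁ → K̄ˣ` by the restriction of an equivariant
# `P → K̄ˣ` so that it takes values of valuation `0`, without changing `δ₀ h` (valuation splitting)

Topic `NumberTheory/GaloisRepresentations`; namespace `Literature.NumberTheory.GaloisRepresentations.HomDual`.
Theorems only (plus one auxiliary definition with body, `monomialHom`); no named fact, no instance, no `sorry`.
Sequel to `HomDualPresentation` (door-c6 g16: `dualδ₀`, `dualδ₀_precomp_eq_zero`) and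
`HomPermutationModuleVanishing` (`PermutedBasis`).  Any field `K : Type`; the "valuation" is an abstract
`Γ_K`-invariant additive map `ordQ : K̄ˣ → ℚ` (intended: the unique extension of `v` to `K̄_v`), the
"uniformiser" an invariant `ϖ ∈ K̄ˣ` with `ordQ ϖ = 1`.

THE MATHEMATICS (the unramified refinement of Milne ADT I Lemma 4.13 on the presentation road, `v ∉ T`).  Let
`0 → N₁ —ι→ P —π→ N → 0` be a presentation by a permutation module `P = ℤ[β]` (basis `e` permuted by `Γ_K`),
`N` killed by `n ≥ 1`, and `h : N₁ → K̄ˣ` equivariant.  Suppose `h` extends to a homomorphism `q : P → K̄ˣ`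
(NOT necessarily equivariant — intended: the `Γ_{K^{ur}}`-equivariant extension that exists when `δ₀ h` is
UNRAMIFIED, by `dualδ₀_eq_zero_iff` over `K^{ur}`) whose values have INTEGER valuation (intended: they lie in
`(K^{ur})ˣ`).  Then:
* `ordQ ∘ q` is `Γ_K`-invariant (`ordQ_extension_invariant`): `q ∘ γ − γ ∘ q` kills `ι(N₁)` (as `h` is
  equivariant), so its values are `n`-torsion, of valuation `0`;
* the monomial homomorphism `q'' : e_b ↦ ϖ^{ordQ(q e_b)}` is EQUIVARIANT (`monomialHom`, `monomialHom_mem_invariants`)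
  with `ordQ ∘ q'' = ordQ ∘ q` (`ordQ_monomialHom`);
* **`exists_unitValued_dualδ₀_eq`**: `h' := h − q'' ∘ ι` is equivariant, `δ₀ h' = δ₀ h`, and `ordQ (h' x) = 0` for
  all `x` — a UNIT-VALUED readout representative.

USE: with `K = K_v`, `ordQ` the valuation of `K̄_v`, `ϖ` a uniformiser of `K_v`, and `t_v ∈ H¹_ur` (so that the
extension `q` over `K_v^{ur}` exists and is `(K_v^{ur})ˣ`-valued, of integral valuation since `K_v^{ur}/K_v` is
unramified): the local data `h_v` of hypothesis (R3) of `middleExact_allPlaces_of_readout` can be chosen with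
values in the units at every place outside a finite set, so that the assembled `N₁ → ∏_w E_wˣ` is idèle-valued.
HONEST FRAMING: no case of Poitou–Tate or BSD is proved here.

## References
* J. S. Milne, *Arithmetic Duality Theorems* (2nd ed. 2006), I Lemma 4.13 (proof: the factor at `v ∉ T`,
  `Ext_{g_v}(M^D, 𝒪^{un×}_v) = H(g_v, M^d)`). [MilneADT2006]
* J.-P. Serre, *Local Fields*, GTM 67 (1979), I §7 and II §3 (valuations in unramified extensions). [SerreLocalFields1979]
-/

noncomputable section

namespace Literature.NumberTheory.GaloisRepresentations

namespace HomDual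

open Literature.Algebra.Homology Literature.Algebra.Homology.DiscreteRep ContRepresentation Field
  HomPermutation DiscreteGaloisModule

variable {K : Type} [Field K]
variable {X VP Z : Type}
  [AddCommGroup X] [TopologicalSpace X] [DiscreteTopology X] [Module.Finite ℤ X]
  [AddCommGroup VP] [TopologicalSpace VP] [DiscreteTopology VP] [Module.Finite ℤ VP]
  [AddCommGroup Z] [TopologicalSpace Z] [DiscreteTopology Z] [Module.Finite ℤ Z]
variable {ρX : DiscreteGaloisModule K X} {ρP : DiscreteGaloisModule K VP} {ρZ : DiscreteGaloisModule K Z}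
  {i : ρX.toContRepresentation →ⁱL ρP.toContRepresentation}
  {p : ρP.toContRepresentation →ⁱL ρZ.toContRepresentation}
variable (ordQ : UnitsCarrier K →+ ℚ) (hord : ∀ (σ : absoluteGaloisGroup K) (u : UnitsCarrier K), ordQ (units K σ u) = ordQ u)

/-! ## §1 `ordQ ∘ q` is invariant for any extension `q` of an equivariant `h` with `n`-torsion cokernel -/

omit [TopologicalSpace X] [DiscreteTopology X] [Module.Finite ℤ X] [TopologicalSpace VP] [DiscreteTopology VP]
  [Module.Finite ℤ VP] [TopologicalSpace Z] [DiscreteTopology Z] [Module.Finite ℤ Z] in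
/-- A value killed by `n ≠ 0` has valuation `0` (the target `ℚ` is torsion-free). [cite: SerreLocalFields1979, I §7] -/
theorem ordQ_eq_zero_of_nsmul_eq_zero {n : ℕ} (hn : n ≠ 0) {u : UnitsCarrier K} (hu : n • u = 0) : ordQ u = 0 := by
  have h := congrArg ordQ hu
  rw [map_nsmul, map_zero, nsmul_eq_mul, mul_eq_zero] at h
  exact h.resolve_left (Nat.cast_ne_zero.mpr hn)

include hord in
omit [Module.Finite ℤ VP] [Module.Finite ℤ Z] in
/-- **`ordQ (q (γ y)) = ordQ (q y)`** for an extension `q : P → K̄ˣ` of the equivariant `h : N₁ → K̄ˣ` along `ι`,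
when `N = P/N₁` is killed by `n ≠ 0`: `q ∘ γ − γ ∘ q` kills `ι(N₁)`, so its values are `n`-torsion.
[cite: MilneADT2006, I Lemma 4.13 (proof)] -/
theorem ordQ_extension_invariant (hS : IsSES (toTopRepHom ρX ρP i) (toTopRepHom ρP ρZ p)) {n : ℕ} (hn : n ≠ 0)
    (hZ : ∀ z : Z, n • z = 0) (h : (homGaloisModule ρX (units K)).toTopRep.ρ.invariants)
    (q : VP →ₗ[ℤ] UnitsCarrier K)
    (hq : ∀ x : X, q (i x) = (show X →ₗ[ℤ] UnitsCarrier K from (h.1 : DiscreteRep.HomCarrier X (UnitsCarrier K))) x)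
    (γ : absoluteGaloisGroup K) (y : VP) : ordQ (q (ρP γ y)) = ordQ (q y) := by
  -- `d := q ∘ γ − γ ∘ q` kills `ι(N₁)`
  have hd : ∀ x : X, q (ρP γ (i x)) - units K γ (q (i x)) = 0 := fun x => by
    have hi : ρP γ (i.toContinuousLinearMap x) = i.toContinuousLinearMap (ρX γ x) := by
      simpa [ContinuousRep.toContRepresentation_apply_apply] using (congr($(i.isIntertwining' γ) x)).symm
    change q (ρP γ (i.toContinuousLinearMap x)) - units K γ (q (i.toContinuousLinearMap x)) = 0
    rw [hi]
    change q (i (ρX γ x)) - units K γ (q (i x)) = 0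
    rw [hq, hq, (mem_invariants_iff ρX (units K) h.1).1 h.2 γ x, sub_self]
  -- `n • y ∈ ι(N₁)` since `π (n • y) = n • π y = 0`
  obtain ⟨x, hx⟩ := hS.exact_mid (n • y) (by
    change p (n • y) = 0
    rw [map_nsmul, hZ])
  have hx' : i x = n • y := hx
  have htor : n • (q (ρP γ y) - units K γ (q y)) = 0 := by
    rw [smul_sub, ← map_nsmul, ← map_nsmul, ← map_nsmul, ← map_nsmul, ← hx', hd]
  have h0 := ordQ_eq_zero_of_nsmul_eq_zero ordQ hn htor
  rw [map_sub, hord, sub_eq_zero] at h0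
  exact h0

/-! ## §2 The equivariant monomial homomorphism `e_b ↦ ϖ^{ν b}` -/

variable {β : Type} (e : Module.Basis β ℤ VP)

/-- **The monomial homomorphism `P → K̄ˣ`, `e_b ↦ ν(b) • ϖ`** (additive notation for `ϖ^{ν(b)}`).
[cite: MilneADT2006, I Lemma 4.13 (proof)] -/
def monomialHom (ν : β → ℤ) (ϖ : UnitsCarrier K) : VP →ₗ[ℤ] UnitsCarrier K :=
  e.constr ℤ fun b => ν b • ϖ

omit [TopologicalSpace VP] [DiscreteTopology VP] [Module.Finite ℤ VP] in
/-- On the basis. [cite: MilneADT2006, I Lemma 4.13 (proof)] -/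
@[simp] theorem monomialHom_basis (ν : β → ℤ) (ϖ : UnitsCarrier K) (b : β) : monomialHom e ν ϖ (e b) = ν b • ϖ := by
  rw [monomialHom, Module.Basis.constr_basis]

variable [MulAction (absoluteGaloisGroup K) β]

omit [Module.Finite ℤ VP] in
/-- **The monomial homomorphism is equivariant** when `ν` is `Γ_K`-invariant and `ϖ` is `Γ_K`-fixed.
[cite: MilneADT2006, I Lemma 4.13 (proof)] -/
theorem monomialHom_equivariant (he : PermutedBasis K ρP e) (ν : β → ℤ) (hν : ∀ (γ : absoluteGaloisGroup K) b, ν (γ • b) = ν b)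
    (ϖ : UnitsCarrier K) (hϖ : ∀ γ : absoluteGaloisGroup K, units K γ ϖ = ϖ) (γ : absoluteGaloisGroup K) (y : VP) :
    monomialHom e ν ϖ (ρP γ y) = units K γ (monomialHom e ν ϖ y) := by
  have h : (monomialHom e ν ϖ ∘ₗ (ρP γ : VP →ₗ[ℤ] VP)) = (units K γ : UnitsCarrier K →ₗ[ℤ] UnitsCarrier K) ∘ₗ monomialHom e ν ϖ :=
    e.ext fun b => by
      simp only [LinearMap.coe_comp, Function.comp_apply]
      rw [he, monomialHom_basis, monomialHom_basis, hν, map_zsmul, hϖ]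
  exact LinearMap.congr_fun h y

/-- The monomial homomorphism as an invariant of `Hom(P, K̄ˣ)`. [cite: MilneADT2006, I Lemma 4.13 (proof)] -/
def monomialInvariant (he : PermutedBasis K ρP e) (ν : β → ℤ) (hν : ∀ (γ : absoluteGaloisGroup K) b, ν (γ • b) = ν b)
    (ϖ : UnitsCarrier K) (hϖ : ∀ γ : absoluteGaloisGroup K, units K γ ϖ = ϖ) :
    (homGaloisModule ρP (units K)).toTopRep.ρ.invariants :=
  invariantOfEquivariant ρP (units K) (monomialHom e ν ϖ) (monomialHom_equivariant e he ν hν ϖ hϖ)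

omit [TopologicalSpace VP] [DiscreteTopology VP] [Module.Finite ℤ VP] [MulAction (absoluteGaloisGroup K) β] in
/-- `ordQ (monomialHom y) = ν̄ y` where `ν̄` is the additive extension of `ν` — on the basis: `ordQ (ν b • ϖ) = ν b`.
[cite: SerreLocalFields1979, I §7] -/
theorem ordQ_monomialHom (ν : β → ℤ) (ϖ : UnitsCarrier K) (hϖ : ordQ ϖ = 1) (q : VP →ₗ[ℤ] UnitsCarrier K)
    (hνq : ∀ b, ((ν b : ℤ) : ℚ) = ordQ (q (e b))) (y : VP) : ordQ (monomialHom e ν ϖ y) = ordQ (q y) := by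
  have h : ordQ.toIntLinearMap ∘ₗ monomialHom e ν ϖ = ordQ.toIntLinearMap ∘ₗ q :=
    e.ext fun b => by
      simp only [LinearMap.coe_comp, Function.comp_apply, AddMonoidHom.coe_toIntLinearMap]
      rw [monomialHom_basis, map_zsmul, hϖ, zsmul_eq_mul, mul_one, hνq]
  exact LinearMap.congr_fun h y

/-! ## §3 A unit-valued representative with the same `δ₀` -/

omit [Module.Finite ℤ Z] in
/-- The restriction `q ∘ ι` of an INVARIANT (equivariant) `q : P → A` is an invariant of `Hom(N₁, A)`.
[cite: MilneADT2006, I §0 (0.8)] -/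
theorem precomp_mem_invariants {W : Type} [AddCommGroup W] [TopologicalSpace W] [DiscreteTopology W]
    (ρA : DiscreteGaloisModule K W) (q : (homGaloisModule ρP ρA).toTopRep.ρ.invariants) :
    precomp ρX ρP ρA i (q.1 : DiscreteRep.HomCarrier VP W) ∈ (homGaloisModule ρX ρA).toTopRep.ρ.invariants := by
  rw [mem_invariants_iff]
  intro σ x
  rw [precomp_apply_apply, precomp_apply_apply]
  have hi : i.toContinuousLinearMap (ρX σ x) = ρP σ (i.toContinuousLinearMap x) := by
    simpa [ContinuousRep.toContRepresentation_apply_apply] using congr($(i.isIntertwining' σ) x)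
  change (show VP →ₗ[ℤ] W from (q.1 : DiscreteRep.HomCarrier VP W)) (i.toContinuousLinearMap (ρX σ x)) = _
  rw [hi]
  exact (mem_invariants_iff ρP ρA q.1).1 q.2 σ (i x)

/-- `K̄ˣ` is a Baer `ℤ`-module (divisible). [cite: SerreGaloisCohomology1997, II §1.1] -/
theorem baer_unitsCarrier (K : Type) [Field K] : Module.Baer ℤ (UnitsCarrier K) :=
  haveI := divisibleByUnitsCarrier K
  baer_of_divisibleBy (UnitsCarrier K)

include hord in
/-- **Valuation splitting.**  Let `h : N₁ → K̄ˣ` be equivariant and suppose it extends along `ι` to a homomorphism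
`q : P → K̄ˣ` whose values have integer valuation (`N = P/N₁` killed by `n ≠ 0`; `ordQ` invariant; `ϖ` an invariant
element of valuation `1`).  Then there is an equivariant `h' : N₁ → K̄ˣ` with the SAME `δ₀` and `ordQ (h' x) = 0` for
every `x` (namely `h' = h − q'' ∘ ι` for the equivariant monomial homomorphism `q''` with `ordQ ∘ q'' = ordQ ∘ q`).
[cite: MilneADT2006, I Lemma 4.13 (proof)][cite: SerreLocalFields1979, II §3] -/
theorem exists_unitValued_dualδ₀_eq (hS : IsSES (toTopRepHom ρX ρP i) (toTopRepHom ρP ρZ p))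
    (hW : Module.Baer ℤ (UnitsCarrier K)) {n : ℕ} (hn : n ≠ 0)
    (hZ : ∀ z : Z, n • z = 0) (he : PermutedBasis K ρP e) (ϖ : UnitsCarrier K)
    (hϖΓ : ∀ γ : absoluteGaloisGroup K, units K γ ϖ = ϖ) (hϖ : ordQ ϖ = 1)
    (h : (homGaloisModule ρX (units K)).toTopRep.ρ.invariants) (q : VP →ₗ[ℤ] UnitsCarrier K)
    (hq : ∀ x : X, q (i x) = (show X →ₗ[ℤ] UnitsCarrier K from (h.1 : DiscreteRep.HomCarrier X (UnitsCarrier K))) x)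
    (hint : ∀ y : VP, ∃ m : ℤ, (m : ℚ) = ordQ (q y)) :
    ∃ h' : (homGaloisModule ρX (units K)).toTopRep.ρ.invariants,
      dualδ₀ ρX ρP ρZ (units K) i p hS hW h' = dualδ₀ ρX ρP ρZ (units K) i p hS hW h ∧
      ∀ x : X, ordQ ((show X →ₗ[ℤ] UnitsCarrier K from (h'.1 : DiscreteRep.HomCarrier X (UnitsCarrier K))) x) = 0 := by
  classical
  -- the integer valuations of `q` on the basis, a `Γ_K`-invariant function
  choose νf hνf using hint
  let ν : β → ℤ := fun b => νf (e b)
  have hνinv : ∀ (γ : absoluteGaloisGroup K) b, ν (γ • b) = ν b := fun γ b => by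
    apply Int.cast_injective (α := ℚ)
    change (νf (e (γ • b)) : ℚ) = νf (e b)
    rw [hνf, hνf, ← he, ordQ_extension_invariant ordQ hord hS hn hZ h q hq γ (e b)]
  -- the equivariant monomial correction `q''` and `h' = h − q'' ∘ ι`
  let q'' := monomialInvariant e he ν hνinv ϖ hϖΓ
  let v : (homGaloisModule ρX (units K)).toTopRep.ρ.invariants :=
    ⟨precomp ρX ρP (units K) i (q''.1 : DiscreteRep.HomCarrier VP (UnitsCarrier K)),
      precomp_mem_invariants (units K) q''⟩
  refine ⟨h - v, ?_, fun x => ?_⟩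
  · rw [map_sub, dualδ₀_precomp_eq_zero ρX ρP ρZ (units K) i p hS hW q'' v rfl, sub_zero]
  · change ordQ ((show X →ₗ[ℤ] UnitsCarrier K from (h.1 : DiscreteRep.HomCarrier X (UnitsCarrier K))) x -
      (show X →ₗ[ℤ] UnitsCarrier K from
        precomp ρX ρP (units K) i (q''.1 : DiscreteRep.HomCarrier VP (UnitsCarrier K))) x) = 0
    rw [map_sub, precomp_apply_apply, ← hq]
    change ordQ (q (i x)) - ordQ (monomialHom e ν ϖ (i x)) = 0
    rw [ordQ_monomialHom ordQ e ν ϖ hϖ q (fun b => hνf (e b)) (i x), sub_self]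

end HomDual

end Literature.NumberTheory.GaloisRepresentations

end
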